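import Literature.IUT.LogThetaLattice.VerticallyCoricLGPArchPackets
import Literature.IUT.LogThetaLattice.TensorPacketsHermitian
import HarnessLib

/-!
# [IUTchIII] Proposition 3.5 (ii) (b) "(Archimedean Primes)" at the archimedean tensor packet with the
# PRINT-LEVEL integral structure — the closed unit ball of the tensor product Hermitian metric (proof-only
# companion of `VerticallyCoricLGP.lean`; abc-iut cell, layer L6, node IUTchIII:Prop3.5(ii); Hermitian twin of
# abc-iut-w4-d036's container version `VerticallyCoricLGPArchPackets.lean`)

S. Mochizuki, *Inter-universal Teichmüller theory III*, kurims manuscript (May 2020), Prop. 3.5 (ii) (b), p. 105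
[claim: Mochizuki2012, status: disputed]: "For `v_ℚ ∈ 𝕍^arc_ℚ`, the closed unit ball `𝓘(^{S^±_{j+1}}𝓕(^{n,∘}𝔇_≻)_{v_ℚ})`
… contains the image, via the tensor product, over `|t| ∈ {0, …, j}`, of the [relevant] Kummer isomorphisms of
(i), of both (1) the groups of units `(Ψ_cns(^{n,m}𝔉_≻)_{|t|})^×_v`, for `𝕍 ∋ v | v_ℚ`, and (2) the closed balls of
radius `π` inside `(Ψ_cns(^{n,m}𝔉_≻)_{|t|})^{gp}_v` …, for `𝕍 ∋ v | v_ℚ`", each such ball containing, "for each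
`m' ≥ 1`, a subset that surjects, via the `m'`-th iterate of the log-link …, onto the subset of the group of units
… on which this iterate is defined"; Prop. 3.2 (ii), pp. 98–99: at `v_ℚ ∈ 𝕍^arc_ℚ` the integral structure
`𝓘(^A𝒟^⊢_{v_ℚ})` IS "the closed unit ball of … the induced tensor product Hermitian metric on `log(^A𝒟^⊢_{v_ℚ})`",
each log-shell `𝓘_{†𝒟^⊢_v} = {|a| ≤ π}` being the unit ball of its factor.

abc-iut-L6-t4 types the clause as the predicate `Prop35ii_b I G U B κ lam Dom` (`VerticallyCoricLGP.lean`).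
abc-iut-w4-d036 (`VerticallyCoricLGPArchPackets.lean`, p413342) discharges it at the archimedean packet
`M_I = ⊗_{i∈I} ⊕_{v∈V} ℂ_v` with the shell READ AS the [IUTchIV] Thm. 1.10 Step (vii) CONTAINER `π^{|I|}·B_I` and with
unit groups `∏_{i,v} 𝒪^×` (a unit at every place in each factor). THIS FILE proves the clause for the PRINT-LEVEL
shell — abc-iut-w4-d039's Hermitian unit ball `hermitianBallN I V π` (`TensorPacketsHermitian.lean`, p412100) —
with the unit groups and radius-`π` balls AS PRINTED: in each tensor factor `|t|` an element of
`(Ψ_cns)^×_v` resp. of the radius-`π` ball at ONE place `v | v_ℚ` (a vector of `⊕_w ℂ_w` supported at `v`):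

* data: ambient `X := MPacketN ℝ (ArchComponents I V)` (`= M_I`, `mPacketN_archComponents_eq`); shell
  `I := hermitianBallN I V Real.pi`; carriers `G m := I → V × ℂ` (per factor: a place `v` and an element of the
  universal covering `Ψ^∼ ≅ ℂ` at `v`, Def. 1.1 (ii)); unit groups `U m := {g | ∀ i, ‖(g i).2‖ = 1}`; radius-`π`
  balls `B m := {g | ∀ i, ‖(g i).2‖ ≤ π}`; Kummer maps `κ m (g) := ⊗_i single_{(g i).1} (g i).2` (the pure tensor
  of the single-place vectors, read in the coric copy); the `m'`-th iterate of the log-link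
  `lam m m' (g) := (v_i, exp^[m'] z_i)_i` (the `m'`-fold covering map at the SAME place — the log-link at `v` acts
  on the `v`-component); `Dom m m' := {g | ∀ i, (g i).2 ∈ arcIterDomain m'}`;
* **`prop35ii_b_archHermitian`** — `Prop35ii_b` HOLDS for this data: (1), (2) because a single-place vector of
  length `≤ π` lies in the direct-sum Hermitian unit ball (`single_mem_hermitianBall1`: `Σ_w |m_w|² = |z|² ≤ π²`)
  and pure tensors of such lie in the tensor-product ball (d039's `tprod_mem_hermitianBallN`); the surjection
  clause from abc-iut-c312-12/d036's one-factor witness `exists_arcWitness`, place tags carried along;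
* `Prop35ii_b.mono_shell`, `prop35ii_b_archHermitian_container` — the clause is monotone in the shell, so it
  also holds for the container `2^{(|I|−1)/2}·π^{|I|}·B_I` of ANY direct sum decomposition `Φ` (d039's
  comparison `hermitianBallN_subset_smul_ball`; the factor `2^{(|I|−1)/2}` is [IUTchIV] Prop. 1.5 (iii)'s
  "direct sum metric = `2^{|I|−1}` × tensor product metric").

Why the single-place carriers (RQ7 note of 2026-08-26T00:17Z): a vector with a unit at EVERY place `w | v_ℚ` has
`Σ_w |u_w|² = |V|` and lies in the direct-sum unit ball only if `|V| ≤ π²`; print's (b)(1) concerns the image of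
each `(Ψ_cns)^×_v` separately, which is what is proved here. No new definitions; classical; nothing here bears on
the disputed [IUTchIII] Cor. 3.12 or takes a side.
-/

noncomputable section

namespace Literature.IUT.LogThetaLattice

open Set
open Literature.IUT.LogVolume Literature.IUT.LogVolume.Prop15iii PiTensorProduct
open scoped Pointwise

variable {I V : Type} [Fintype I] [DecidableEq I] [Fintype V] [DecidableEq V]

/-! ### Single-place vectors lie in the direct-sum Hermitian ball -/

/-- `Σ_w ‖(single_v z)_w‖² = ‖z‖²`. [claim: Mochizuki2012, status: disputed] -/
theorem sum_norm_sq_single (v : V) (z : ℂ) :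
    ∑ w, ‖(Pi.single v z : V → ℂ) w‖ ^ 2 = ‖z‖ ^ 2 := by
  rw [Finset.sum_eq_single v]
  · rw [Pi.single_eq_same]
  · intro w _ hw
    rw [Pi.single_eq_of_ne hw, norm_zero]
    ring
  · intro h
    exact absurd (Finset.mem_univ v) h

omit [Fintype I] [DecidableEq I] in
/-- **IUTchIII:Prop3.2(ii)** (kurims p. 99) at `v_ℚ ∈ 𝕍^arc_ℚ`: an element of the radius-`π` log-shell of ONE
summand `log(^α𝒟^⊢_v) = ℂ_v`, viewed in `log(^α𝒟^⊢_{v_ℚ}) = ⊕_w ℂ_w`, lies in the closed unit ball of the direct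
sum Hermitian metric `𝓘(^α𝒟^⊢_{v_ℚ})` (d039's `hermitianBall1`, log-shell radius `r`).
[claim: Mochizuki2012, status: disputed] -/
theorem single_mem_hermitianBall1 {r : ℝ} (i : I) (v : V) {z : ℂ} (hz : ‖z‖ ≤ r) :
    (Pi.single v z : MPacket1 (ArchComponents I V) i) ∈ hermitianBall1 I V r i := by
  rw [mem_hermitianBall1_iff]
  change ∑ w, ‖(Pi.single v z : V → ℂ) w‖ ^ 2 ≤ r ^ 2
  rw [sum_norm_sq_single]
  exact pow_le_pow_left₀ (norm_nonneg z) hz 2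

/-! ### Proposition 3.5 (ii) (b) at the Hermitian unit ball of the archimedean packet -/

/-- **IUTchIII:Prop3.5(ii)(b)** (kurims p. 105) **"(Archimedean Primes)" for the PRINT-LEVEL integral
structure** — the closed unit ball `𝓘(^{S^±_{j+1}}𝓕(^{n,∘}𝔇_≻)_{v_ℚ})` of the tensor product Hermitian metric on
`M_I = ⊗_{i∈I} ⊕_{v∈V} ℂ_v` (abc-iut-w4-d039's `hermitianBallN I V π`): with carriers "a place `v | v_ℚ` and an
element of `Ψ^∼_v ≅ ℂ`" per tensor factor, unit groups `(Ψ_cns)^×_v = {|z| = 1}`, radius-`π` balls, Kummer maps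
`g ↦ ⊗_i single_{v_i} z_i`, the `m'`-fold covering map at the same place as the `m'`-th iterate of the log-link
and `arcIterDomain m'` as its domain on the units — abc-iut-L6-t4's `Prop35ii_b` HOLDS: (1) `⊗` of single-place
units `∈ 𝓘`; (2) `⊗` of single-place radius-`π` vectors `∈ 𝓘`; and for each `m' ≥ 1` the product of
abc-iut-c312-12's chosen one-factor witnesses (place tags carried along) is a subset of the radius-`π` balls that
the iterate carries onto exactly the portion of the units on which it is defined. PROVED.
[claim: Mochizuki2012, status: disputed] -/
theorem prop35ii_b_archHermitian :
    Prop35ii_b (X := MPacketN ℝ (ArchComponents I V)) (hermitianBallN I V Real.pi)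
      (fun _ : ℤ => I → V × ℂ)
      (fun _ => {g | ∀ i, (g i).2 ∈ arcUnits}) (fun _ => {g | ∀ i, (g i).2 ∈ arcLogShell})
      (fun _ g => tprod ℝ fun i => (Pi.single (g i).1 (g i).2 : MPacket1 (ArchComponents I V) i))
      (fun _ (m' : ℕ) g => some (fun i => ((g i).1, Complex.exp^[m'] (g i).2)))
      (fun _ (m' : ℕ) => {g | ∀ i, (g i).2 ∈ arcIterDomain m'}) := by
  refine ⟨fun m => ?_, fun m => ?_, fun m m' hm => ?_⟩
  · rintro _ ⟨g, hg, rfl⟩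
    exact tprod_mem_hermitianBallN fun i =>
      single_mem_hermitianBall1 i (g i).1 (arcUnits_subset_arcLogShell (hg i))
  · rintro _ ⟨g, hg, rfl⟩
    exact tprod_mem_hermitianBallN fun i => single_mem_hermitianBall1 i (g i).1 (hg i)
  · obtain ⟨T, hT, hTeq⟩ := exists_arcWitness hm
    refine ⟨{g | ∀ i, (g i).2 ∈ T}, fun g hg i => hT (hg i), ?_⟩
    ext y
    simp only [Option.some.injEq, mem_setOf_eq, mem_inter_iff]
    constructor
    · rintro ⟨x, hx, rfl⟩
      have hmem : ∀ i, Complex.exp^[m'] (x i).2 ∈ arcUnits ∩ arcIterDomain m' := fun i => by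
        rw [← hTeq]
        exact ⟨(x i).2, hx i, rfl⟩
      exact ⟨fun i => (hmem i).1, ⟨fun i => ((x i).1, Complex.exp^[m'] (x i).2), fun i => (hmem i).2, rfl⟩⟩
    · rintro ⟨hyU, z, hz, hyz⟩
      rw [hyz] at hyU ⊢
      have hpre : ∀ i, ∃ x ∈ T, Complex.exp^[m'] x = (z i).2 := fun i => by
        have h : (z i).2 ∈ Complex.exp^[m'] '' T := by
          rw [hTeq]
          exact ⟨hyU i, hz i⟩
        exact h
      choose x hxT hxz using hpre
      exact ⟨fun i => ((z i).1, x i), hxT, funext fun i => Prod.ext rfl (hxz i)⟩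

/-! ### Monotonicity in the shell, and the container form -/

universe u u' w in
/-- `Prop35ii_b` is monotone in the shell: clauses (1), (2) are containments in the shell and the surjection
clause does not mention it (bookkeeping). [claim: Mochizuki2012, status: disputed] -/
theorem Prop35ii_b.mono_shell {X : Type u} {I₁ I₂ : Set X} {G : ℤ → Type w} {U B : ∀ m, Set (G m)}
    {κ : ∀ m, G m → X} {lam : ∀ m (m' : ℕ), G m → Option (G (m - m'))} {Dom : ∀ m (m' : ℕ), Set (G m)}
    (h : Prop35ii_b I₁ G U B κ lam Dom) (hI : I₁ ⊆ I₂) : Prop35ii_b I₂ G U B κ lam Dom :=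
  ⟨fun m => (h.1 m).trans hI, fun m => (h.2.1 m).trans hI, h.2.2⟩

/-- **The container form** ([IUTchIV] Thm. 1.10 Step (vii) / Prop. 1.5 (iii)): the same data satisfy `Prop35ii_b`
for the container `(2^{(|I|−1)/2}·π^{|I|})·B_I` of ANY direct sum decomposition `Φ` of `M_I` into copies of `ℂ`,
by abc-iut-w4-d039's comparison `hermitianBallN_subset_smul_ball` (`𝓘 ⊆ √(2^{|I|−1})·π^{|I|}·B_I`).
[claim: Mochizuki2012, status: disputed] -/
theorem prop35ii_b_archHermitian_container {J : Type} [Fintype J] (Φ : Decomposition I V J) :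
    Prop35ii_b (X := MPacketN ℝ (ArchComponents I V))
      ((Real.sqrt (2 ^ (Fintype.card I - 1)) * Real.pi ^ Fintype.card I) • ball Φ)
      (fun _ : ℤ => I → V × ℂ)
      (fun _ => {g | ∀ i, (g i).2 ∈ arcUnits}) (fun _ => {g | ∀ i, (g i).2 ∈ arcLogShell})
      (fun _ g => tprod ℝ fun i => (Pi.single (g i).1 (g i).2 : MPacket1 (ArchComponents I V) i))
      (fun _ (m' : ℕ) g => some (fun i => ((g i).1, Complex.exp^[m'] (g i).2)))
      (fun _ (m' : ℕ) => {g | ∀ i, (g i).2 ∈ arcIterDomain m'}) :=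
  prop35ii_b_archHermitian.mono_shell (hermitianBallN_subset_smul_ball Real.pi_pos Φ)

end Literature.IUT.LogThetaLattice

end
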